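import Literature.NumberTheory.LFunctions.RelativeClassNumberFormula
import Literature.NumberTheory.LFunctions.AbelianFieldDedekindZeta
import Literature.NumberTheory.LFunctions.DedekindZetaFunctionalEquationProofs
import Literature.NumberTheory.LFunctions.DedekindZetaNonvanishing
import Literature.NumberTheory.LFunctions.DedekindZetaERHProofs
import Literature.NumberTheory.LFunctions.DirichletLAtZero
import Literature.NumberTheory.NumberFields.ArithmeticEquivalenceProofs
import Mathlib.NumberTheory.NumberField.CMField
import HarnessLib

/-!
# The relative class number formula `h⁻ = Q w ∏_{χ odd} (−½ B_{1,χ})` — proof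
# (discharge of `Lang1990_relativeClassNumberFormula`)

Topic `Literature/NumberTheory/LFunctions`; sibling proof file of `RelativeClassNumberFormula.lean`,
whose named fact `Literature.NumberTheory.LFunctions.Lang1990_relativeClassNumberFormula` (Lang,
*Cyclotomic Fields I and II*, Ch. 3 §3, Theorem 3.2 and formula CNF⁻: for an imaginary abelian
field `K`, `h = h⁺ Q w 2^{−N/2} ∏_{χ odd} −B_{1,χ}`, i.e. `h⁻ = Q w ∏_{χ odd} −½ B_{1,χ}`) is
PROVED here as `Literature.NumberTheory.LFunctions.Lang1990_relativeClassNumberFormula_holds`.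
Everything in this file is proved (theorems only: no definition, no named fact, no `sorry`).

## Source and proof architecture

S. Lang, *Cyclotomic Fields I and II*, GTM 121, Ch. 3 §3 (held copy, chunks p0064–p0068). Lang's
printed route to Theorem 3.2: (i) `ζ_K(s) = ∏_χ L(s, χ₀)` over the primitive characters induced by
the characters of `Gal(K/ℚ)` (p. 75); (ii) the residue formula CNF,
`2^{r₁}(2π)^{r₂} hR/(w√d) = ∏_{χ≠1} L(1, χ)` (p. 77); (iii) Theorem 3.1, `∏ m(χ) = d` and
`∏ S(χ) = i^{N/2} √d`, proved from the functional equations of `ζ_K` and of the `L(s, χ)` (after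
Hasse); (iv) `L(1, χ) = πi S(χ) B_{1,χ̄}/m` for odd `χ` (§2); (v) the Lemma
`(E : μ_K E⁺) = 2^{N/2−1} R⁺/R` (p. 78), giving Thm. 3.2 "reading the class number formula in the
real case applied to `K⁺`".

The formalisation follows this architecture with one shortcut that uses exactly the inputs of
Lang's proof of Thm. 3.1 (the two functional equations) but avoids evaluating discriminants and
Gauss sums separately: the quotient `R(s) := ζ_K(s)/ζ_{K⁺}(s) = ∏_{χ odd} L(s, χ₀)` is compared
at `s = 0` instead of `s = 1`.

* (i) is `AbelianDedekindZeta.dedekindZetaCont_eq_prod_characterGroup_LFunction`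
  (`AbelianFieldDedekindZeta.lean`, Washington Thm. 4.3 for every intermediate field of `ℚ(ζ_n)`),
  applied to `F` and to its real subfield `F₊ = L^{⟨Gal(L/F), σ_{-1}⟩}`; the characters of `F₊` are
  the EVEN characters of `F` (§3), so `R(s) = ∏_{χ ∈ X(F) odd} L(s, χ₀)` is entire and
  `ζ_F = ζ_{F₊} · R` off `s = 1`.  `F₊ ≃ maximalRealSubfield F` (§2: `σ_{-1}` is complex
  conjugation under every embedding, `embedding_symm_neg_one_apply`), and isomorphic fields have
  the same zeta function (tree `ArithmeticallyEquivalent.dedekindZeta_eq`, Perlis 1977).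
* (ii)+(iii) `RelativeClassNumber.cpow_discr_mul_mul_residue_eq` (§1): for `K` totally complex,
  `K'` totally real with `r₂(K) = r₁(K') = r` and `ζ_K = ζ_{K'} R`, Hecke's functional equations
  (tree `completedDedekindZeta_one_sub_holds`, Neukirch VII (5.10)) divided by one another, with
  `Γ_ℂ(s) = Γ_ℝ(s)Γ_ℝ(s+1)` cancelling the pole of `Γ_ℝ(1−s)`, and the residues (tree
  `tendsto_sub_one_mul_dedekindZetaCont_holds`; Mathlib `NumberField.dedekindZeta_residue`, the
  Dirichlet class number formula (ii)) give `√d_{K'} · R(0) · ρ_{K'} = √d_K · π^{−r} · ρ_K`, in which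
  the discriminants cancel after inserting `ρ = 2^{r₁}(2π)^{r₂} h Reg/(w √d)`:
  `R(0) = (Reg_K/Reg_{K'}) (h/h') (w'/w)`, `w' = 2` (`torsionOrder_eq_two_of_isTotallyReal`).
* (iv) at `s = 0`: `L(0, χ₀) = −B_{1,χ₀}` for odd `χ` (tree `dirichletLFunction_apply_zero_of_odd`,
  in Lang's normalisation `bernoulliOneChar`: `LFunction_zero_eq_neg_bernoulliOneChar`), so
  `R(0) = ∏_{χ odd} (−B_{1,χ₀})`.
* (v) is Mathlib's `NumberField.IsCMField.regulator_div_regulator_eq_two_pow_mul_indexRealUnits_inv`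
  (`Reg_K/Reg_{K⁺} = 2^{rank K}/Q`), `rank K = r − 1`.
* Assembly (§4): `h = h⁺ Q w 2^{−r} ∏_{χ odd} (−B_{1,χ₀})` with `#{χ odd} = r = N/2`
  (`card_characterGroup`: `#X(F) = [F:ℚ] = 2r`, `#X(F₊) = [F₊:ℚ] = r`), which is Theorem 3.2 /
  CNF⁻ in the tree's form `h(F) = h(F⁺) · Q · w · ∏_{χ odd} (−½ B_{1,χ₀})`.

## References

* S. Lang, *Cyclotomic Fields I and II*, GTM 121, Springer 1990, Ch. 3 §§2–3, Thm. 3.1, Thm. 3.2,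
  CNF⁻ (held copy chunks p0064–p0068). [Lang1990]
* L. C. Washington, *Introduction to Cyclotomic Fields*, GTM 83, Thm. 4.3, Thm. 4.17. [Washington1997]
* J. Neukirch, *Algebraic Number Theory*, Springer 1999, VII (5.10)–(5.11). [NeukirchANT1999]
* R. Perlis, *On the equation `ζ_K(s) = ζ_{K'}(s)`*, J. Number Theory 9 (1977). [Perlis1977]
-/

noncomputable section

open NumberField NumberField.InfinitePlace IsCyclotomicExtension.Rat IntermediateField

namespace Literature.NumberTheory.LFunctions

namespace RelativeClassNumber

/-! ## 1. The quotient of the functional equations of `ζ_K` and `ζ_{K'}` at `s → 1` -/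

section Analytic

open Complex Filter Topology
open scoped Real


/-- Near `s = 1` (punctured), `s` is not an integer. [folklore] -/
theorem eventually_ne_intCast :
    ∀ᶠ s : ℂ in 𝓝[≠] (1 : ℂ), ∀ m : ℤ, s ≠ m := by
  rw [eventually_nhdsWithin_iff, Metric.eventually_nhds_iff]
  refine ⟨1, one_pos, fun s hs hs1 m hm => ?_⟩
  subst hm
  have h : ‖((m - 1 : ℤ) : ℂ)‖ < 1 := by
    rw [Int.cast_sub, Int.cast_one, ← dist_eq_norm]
    exact hs
  rw [Complex.norm_intCast] at h
  have h' : |m - 1| < 1 := by exact_mod_cast h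
  rw [Int.abs_lt_one_iff, sub_eq_zero] at h'
  exact hs1 (by rw [Set.mem_singleton_iff, h', Int.cast_one])

/-- `Γ_ℝ` is continuous at every `s` with `re s > 0`. [folklore] -/
theorem continuousAt_Gammaℝ {s : ℂ} (hs : 0 < s.re) : ContinuousAt Gammaℝ s := by
  have h1 : ContinuousAt (fun z ↦ (Gammaℝ z)⁻¹) s :=
    differentiable_Gammaℝ_inv.continuous.continuousAt
  have h2 := h1.inv₀ (inv_ne_zero (Gammaℝ_ne_zero_of_re_pos hs))
  have h3 : (fun z : ℂ ↦ ((Gammaℝ z)⁻¹)⁻¹) = Gammaℝ := by funext z; simp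
  have h4 : ContinuousAt (fun z : ℂ ↦ ((Gammaℝ z)⁻¹)⁻¹) s := h2
  rwa [h3] at h4

/-- `Γ_ℂ` is continuous at every `s` with `re s > 0`. [folklore] -/
theorem continuousAt_Gammaℂ {s : ℂ} (hs : 0 < s.re) : ContinuousAt Gammaℂ s := by
  have h : Gammaℂ = fun z ↦ Gammaℝ z * Gammaℝ (z + 1) := by
    funext z; rw [Gammaℝ_mul_Gammaℝ_add_one]
  rw [h]
  refine (continuousAt_Gammaℝ hs).mul ?_
  refine (continuousAt_Gammaℝ (s := s + 1) ?_).comp (f := fun z : ℂ ↦ z + 1) ?_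
  · simp only [add_re, one_re]; linarith
  · exact (continuous_id.add continuous_const).continuousAt

variable {K K' : Type*} [Field K] [NumberField K] [Field K'] [NumberField K']

/-- **Quotient of the functional equations of `ζ_K` and `ζ_{K'}` at `s → 1`.** Let `K` be a
totally complex and `K'` a totally real number field with `r₂(K) = r₁(K') = r`, and let
`R : ℂ → ℂ` be continuous at `0` and `1` with `ζ_K(s) = ζ_{K'}(s) R(s)` for all `s ≠ 1` (the
continued zeta functions). Then
`|d_{K'}|^{1/2} · R(0) · ρ_{K'} = |d_K|^{1/2} · π^{-r} · ρ_K`, `ρ` the residues at `s = 1`.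
Proof: divide Hecke's functional equations `Λ_K(1−s) = Λ_K(s)`, `Λ_{K'}(1−s) = Λ_{K'}(s)`
(tree `completedDedekindZeta_one_sub_holds`), use `Γ_ℂ(s) = Γ_ℝ(s)Γ_ℝ(s+1)` to cancel the pole of
`Γ_ℝ(1 − s)`, multiply by `s − 1` and let `s → 1` (tree `tendsto_sub_one_mul_dedekindZetaCont_holds`;
`Γ_ℝ(1) = 1`, `Γ_ℂ(1) = 1/π`). This is the route of Lang's proof of Thm. 3.1 (functional
equations, after Hasse) applied to the quotient `ζ_K/ζ_{K⁺}` directly, so that discriminants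
and Gauss sums never have to be evaluated separately.
[cite: Lang1990, Ch. 3 §3, Thm. 3.1 (proof) and Thm. 3.2] -/
theorem cpow_discr_mul_mul_residue_eq (hK : nrRealPlaces K = 0) (hK' : nrComplexPlaces K' = 0)
    (hr : nrRealPlaces K' = nrComplexPlaces K) {R : ℂ → ℂ} (hR0 : ContinuousAt R 0)
    (hR1 : ContinuousAt R 1)
    (hζ : ∀ s : ℂ, s ≠ 1 → dedekindZetaCont K s = dedekindZetaCont K' s * R s) :
    ((NumberField.discr K').natAbs : ℂ) ^ ((1 : ℂ) / 2) * R 0 *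
        (NumberField.dedekindZeta_residue K' : ℂ) =
      ((NumberField.discr K).natAbs : ℂ) ^ ((1 : ℂ) / 2) * (π : ℂ)⁻¹ ^ nrComplexPlaces K *
        (NumberField.dedekindZeta_residue K : ℂ) := by
  set r := nrComplexPlaces K with hrdef
  set dK : ℂ := ((NumberField.discr K).natAbs : ℂ) with hdK
  set dK' : ℂ := ((NumberField.discr K').natAbs : ℂ) with hdK'
  have hdK0 : dK ≠ 0 := by
    rw [hdK, Nat.cast_ne_zero, Int.natAbs_ne_zero]; exact NumberField.discr_ne_zero K
  have hdK'0 : dK' ≠ 0 := by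
    rw [hdK', Nat.cast_ne_zero, Int.natAbs_ne_zero]; exact NumberField.discr_ne_zero K'
  set ρ : ℂ := (NumberField.dedekindZeta_residue K : ℂ) with hρ
  set ρ' : ℂ := (NumberField.dedekindZeta_residue K' : ℂ) with hρ'
  -- the residues
  have hg : Tendsto (fun s : ℂ ↦ (s - 1) * dedekindZetaCont K' s) (𝓝[≠] 1) (𝓝 ρ') :=
    tendsto_sub_one_mul_dedekindZetaCont_holds K'
  have hf : Tendsto (fun s : ℂ ↦ (s - 1) * dedekindZetaCont K s) (𝓝[≠] 1) (𝓝 ρ) :=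
    tendsto_sub_one_mul_dedekindZetaCont_holds K
  have hR1' : Tendsto R (𝓝[≠] 1) (𝓝 (R 1)) := hR1.tendsto.mono_left nhdsWithin_le_nhds
  have hmem : ∀ᶠ s : ℂ in 𝓝[≠] (1 : ℂ), s ≠ 1 := eventually_mem_nhdsWithin
  -- Step A: `ρ = ρ' R(1)`
  have hA : ρ = ρ' * R 1 := by
    have h1 : Tendsto (fun s : ℂ ↦ (s - 1) * dedekindZetaCont K' s * R s) (𝓝[≠] 1)
        (𝓝 (ρ' * R 1)) := hg.mul hR1'
    have h2 : (fun s : ℂ ↦ (s - 1) * dedekindZetaCont K s) =ᶠ[𝓝[≠] 1]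
        fun s : ℂ ↦ (s - 1) * dedekindZetaCont K' s * R s :=
      hmem.mono fun s hs ↦ by
        show (s - 1) * dedekindZetaCont K s = (s - 1) * dedekindZetaCont K' s * R s
        rw [hζ s hs, mul_assoc]
    exact tendsto_nhds_unique hf (h1.congr' h2.symm)
  -- Step B: the identity near `s = 1`
  have hGamma : ∀ s : ℂ, dedekindGammaFactor K s = dK ^ (s / 2) * Gammaℂ s ^ r := by
    intro s; rw [dedekindGammaFactor, hK, pow_zero, mul_one]
  have hGamma' : ∀ s : ℂ, dedekindGammaFactor K' s = dK' ^ (s / 2) * Gammaℝ s ^ r := by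
    intro s; rw [dedekindGammaFactor, hK', pow_zero, mul_one, hr]
  have hident : ∀ᶠ s : ℂ in 𝓝[≠] (1 : ℂ),
      dK ^ ((1 - s) / 2) * Gammaℝ (2 - s) ^ r * R (1 - s) * (dK' ^ (s / 2) * Gammaℝ s ^ r) *
          ((s - 1) * dedekindZetaCont K' s) =
        dK' ^ ((1 - s) / 2) * (dK ^ (s / 2) * Gammaℂ s ^ r) * R s *
          ((s - 1) * dedekindZetaCont K' s) := by
    filter_upwards [eventually_ne_intCast, hmem] with s hsZ hs1
    have hs0 : s ≠ 0 := by simpa using hsZ 0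
    have h1s : 1 - s ≠ 1 := by
      intro h; apply hs0; linear_combination -h
    -- the functional equations
    have FE := completedDedekindZeta_one_sub_holds (K := K) hsZ
    have FE' := completedDedekindZeta_one_sub_holds (K := K') hsZ
    simp only [completedDedekindZeta, hGamma, hGamma'] at FE FE'
    rw [hζ _ h1s, hζ _ hs1] at FE
    -- `Γ_ℂ(1 - s) = Γ_ℝ(1 - s) Γ_ℝ(2 - s)`
    have hC : Gammaℂ (1 - s) = Gammaℝ (1 - s) * Gammaℝ (2 - s) := by
      rw [← Gammaℝ_mul_Gammaℝ_add_one (1 - s)]; ring_nf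
    -- `Γ_ℝ(1 - s) ≠ 0`
    have hR0' : Gammaℝ (1 - s) ≠ 0 := by
      rw [Ne, Gammaℝ_eq_zero_iff]
      rintro ⟨k, hk⟩
      apply hsZ (1 + 2 * k)
      push_cast
      linear_combination -hk
    -- combine: multiply `FE` by `dK' ^ ((1-s)/2) * Γℝ(1-s)^r` and substitute `FE'`
    have key : dK ^ ((1 - s) / 2) * Gammaℂ (1 - s) ^ r * R (1 - s) *
        (dK' ^ (s / 2) * Gammaℝ s ^ r * dedekindZetaCont K' s) =
        dK' ^ ((1 - s) / 2) * Gammaℝ (1 - s) ^ r *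
          (dK ^ (s / 2) * Gammaℂ s ^ r * (dedekindZetaCont K' s * R s)) := by
      rw [← FE', ← FE]; ring
    rw [hC, mul_pow] at key
    have hpow : Gammaℝ (1 - s) ^ r ≠ 0 := pow_ne_zero _ hR0'
    have key2 : dK ^ ((1 - s) / 2) * Gammaℝ (2 - s) ^ r * R (1 - s) *
        (dK' ^ (s / 2) * Gammaℝ s ^ r * dedekindZetaCont K' s) =
        dK' ^ ((1 - s) / 2) * (dK ^ (s / 2) * Gammaℂ s ^ r * (dedekindZetaCont K' s * R s)) := by
      apply mul_left_cancel₀ hpow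
      linear_combination key
    linear_combination (s - 1) * key2
  -- Step C: limits of both sides
  have hcpow1 : Tendsto (fun s : ℂ ↦ dK ^ ((1 - s) / 2)) (𝓝[≠] 1) (𝓝 1) := by
    have h : Tendsto (fun s : ℂ ↦ (1 - s) / 2) (𝓝[≠] (1 : ℂ)) (𝓝 ((1 - 1) / 2)) :=
      ((continuous_const.sub continuous_id).div_const _).continuousAt.tendsto.mono_left
        nhdsWithin_le_nhds
    have := h.const_cpow (Or.inl hdK0)
    simpa using this
  have hcpow1' : Tendsto (fun s : ℂ ↦ dK' ^ ((1 - s) / 2)) (𝓝[≠] 1) (𝓝 1) := by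
    have h : Tendsto (fun s : ℂ ↦ (1 - s) / 2) (𝓝[≠] (1 : ℂ)) (𝓝 ((1 - 1) / 2)) :=
      ((continuous_const.sub continuous_id).div_const _).continuousAt.tendsto.mono_left
        nhdsWithin_le_nhds
    have := h.const_cpow (Or.inl hdK'0)
    simpa using this
  have hcpow2 : Tendsto (fun s : ℂ ↦ dK ^ (s / 2)) (𝓝[≠] 1) (𝓝 (dK ^ ((1 : ℂ) / 2))) :=
    ((continuous_id.div_const _).continuousAt.tendsto.mono_left nhdsWithin_le_nhds).const_cpow
      (Or.inl hdK0)
  have hcpow2' : Tendsto (fun s : ℂ ↦ dK' ^ (s / 2)) (𝓝[≠] 1) (𝓝 (dK' ^ ((1 : ℂ) / 2))) :=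
    ((continuous_id.div_const _).continuousAt.tendsto.mono_left nhdsWithin_le_nhds).const_cpow
      (Or.inl hdK'0)
  have hΓ2 : Tendsto (fun s : ℂ ↦ Gammaℝ (2 - s) ^ r) (𝓝[≠] 1) (𝓝 1) := by
    have h1 : ContinuousAt (fun s : ℂ ↦ Gammaℝ (2 - s)) 1 := by
      refine (continuousAt_Gammaℝ (s := 2 - 1) (by norm_num)).comp (f := fun s : ℂ ↦ 2 - s) ?_
      exact (continuous_const.sub continuous_id).continuousAt
    have h2 := (h1.tendsto.mono_left (nhdsWithin_le_nhds (s := ({1}ᶜ : Set ℂ)))).pow r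
    have h3 : Gammaℝ (2 - 1) ^ r = 1 := by norm_num [Gammaℝ_one]
    rwa [h3] at h2
  have hΓ1 : Tendsto (fun s : ℂ ↦ Gammaℝ s ^ r) (𝓝[≠] 1) (𝓝 1) := by
    have h2 := ((continuousAt_Gammaℝ (s := 1) (by norm_num)).tendsto.mono_left
      (nhdsWithin_le_nhds (s := ({1}ᶜ : Set ℂ)))).pow r
    rwa [Gammaℝ_one, one_pow] at h2
  have hΓC : Tendsto (fun s : ℂ ↦ Gammaℂ s ^ r) (𝓝[≠] 1) (𝓝 ((π : ℂ)⁻¹ ^ r)) := by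
    have h2 := ((continuousAt_Gammaℂ (s := 1) (by norm_num)).tendsto.mono_left
      (nhdsWithin_le_nhds (s := ({1}ᶜ : Set ℂ)))).pow r
    rwa [Gammaℂ_one, one_div] at h2
  have hRl : Tendsto (fun s : ℂ ↦ R (1 - s)) (𝓝[≠] 1) (𝓝 (R 0)) := by
    have hc : ContinuousAt (fun s : ℂ ↦ (1 : ℂ) - s) 1 :=
      (continuous_const.sub continuous_id).continuousAt
    have h0 : ContinuousAt R ((fun s : ℂ ↦ (1 : ℂ) - s) 1) := by
      simp only [sub_self]; exact hR0
    have h1 : ContinuousAt (fun s : ℂ ↦ R (1 - s)) 1 := ContinuousAt.comp h0 hc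
    have h2 := h1.tendsto
    simp only [sub_self] at h2
    exact h2.mono_left nhdsWithin_le_nhds
  have hL : Tendsto (fun s : ℂ ↦ dK ^ ((1 - s) / 2) * Gammaℝ (2 - s) ^ r * R (1 - s) *
      (dK' ^ (s / 2) * Gammaℝ s ^ r) * ((s - 1) * dedekindZetaCont K' s)) (𝓝[≠] 1)
      (𝓝 (1 * 1 * R 0 * (dK' ^ ((1 : ℂ) / 2) * 1) * ρ')) :=
    (((hcpow1.mul hΓ2).mul hRl).mul (hcpow2'.mul hΓ1)).mul hg
  have hM : Tendsto (fun s : ℂ ↦ dK' ^ ((1 - s) / 2) * (dK ^ (s / 2) * Gammaℂ s ^ r) * R s *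
      ((s - 1) * dedekindZetaCont K' s)) (𝓝[≠] 1)
      (𝓝 (1 * (dK ^ ((1 : ℂ) / 2) * (π : ℂ)⁻¹ ^ r) * R 1 * ρ')) :=
    ((hcpow1'.mul (hcpow2.mul hΓC)).mul hR1').mul hg
  have hlim := tendsto_nhds_unique (hL.congr' hident) hM
  rw [hA]
  linear_combination hlim


end Analytic


/-! ## 2. Complex conjugation on `ℚ(ζ_n)` is `σ_{-1}` -/

section Conj

variable {n : ℕ} [NeZero n] (L : Type*) [Field L] [NumberField L]
  [hL : IsCyclotomicExtension {n} ℚ L]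

/-- `σ_{-1} ζ · ζ = 1` for the element `σ_{-1}` of `Gal(ℚ(ζ_n)/ℚ)` with `a_{σ_{-1}} = -1`.
[folklore] -/
theorem symm_neg_one_apply_zeta_mul_zeta :
    (galEquivZMod n L).symm (-1) (IsCyclotomicExtension.zeta n ℚ L) *
      IsCyclotomicExtension.zeta n ℚ L = 1 := by
  have hζ := IsCyclotomicExtension.zeta_spec n ℚ L
  set σ := (galEquivZMod n L).symm (-1) with hσ
  have h1 : σ (IsCyclotomicExtension.zeta n ℚ L) =
      IsCyclotomicExtension.zeta n ℚ L ^ ((galEquivZMod n L σ : ZMod n)).val :=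
    galEquivZMod_apply_of_pow_eq n L σ hζ.pow_eq_one
  have h2 : galEquivZMod n L σ = -1 := by rw [hσ, MulEquiv.apply_symm_apply]
  rw [h1, h2, ← pow_succ, hζ.pow_eq_one_iff_dvd, ← ZMod.natCast_eq_zero_iff]
  push_cast
  simp

/-- **Every complex embedding of `ℚ(ζ_n)` intertwines `σ_{-1}` with complex conjugation**:
`Ψ(σ_{-1} x) = conj(Ψ x)` (both `ℚ`-algebra maps send `ζ` to `Ψ(ζ)⁻¹ = conj Ψ(ζ)`, and `ζ`
generates). (Washington, *Introduction to Cyclotomic Fields*, Ch. 2; Lang, *Cyclotomic Fields I*,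
Ch. 3 §2: "even"/"odd" characters and the real subfield.) [folklore] -/
theorem embedding_symm_neg_one_apply (Ψ : L →+* ℂ) (x : L) :
    Ψ ((galEquivZMod n L).symm (-1) x) = starRingEnd ℂ (Ψ x) := by
  have hζ := IsCyclotomicExtension.zeta_spec n ℚ L
  set σ := (galEquivZMod n L).symm (-1) with hσ
  set ζ := IsCyclotomicExtension.zeta n ℚ L with hζdef
  let f : L →ₐ[ℚ] ℂ := (Ψ.comp (σ : L ≃ₐ[ℚ] L).toRingEquiv.toRingHom).toRatAlgHom
  let g : L →ₐ[ℚ] ℂ := ((starRingEnd ℂ).comp Ψ).toRatAlgHom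
  have hΨζ : ‖Ψ ζ‖ = 1 :=
    Complex.norm_eq_one_of_pow_eq_one (by rw [← map_pow, hζ.pow_eq_one, map_one]) (NeZero.ne n)
  have hfg : f = g := by
    refine (hζ.powerBasis ℚ).algHom_ext ?_
    rw [hζ.powerBasis_gen ℚ]
    change Ψ (σ ζ) = starRingEnd ℂ (Ψ ζ)
    have hprod : Ψ (σ ζ) * Ψ ζ = 1 := by
      rw [← map_mul, hσ, hζdef, symm_neg_one_apply_zeta_mul_zeta L, map_one]
    rw [← Complex.inv_eq_conj hΨζ]
    exact eq_inv_of_mul_eq_one_left hprod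
  have := congrArg (fun h : L →ₐ[ℚ] ℂ ↦ h x) hfg
  exact this

variable (F : IntermediateField ℚ L) [Normal ℚ F]

/-- The restriction of `σ_{-1}` to a normal subfield `F ⊆ ℚ(ζ_n)` is complex conjugation under
every embedding `ψ : F → ℂ`: `ψ(σ_{-1}|_F x) = conj(ψ x)` (extend `ψ` to `ℚ(ζ_n)`).
[folklore] -/
theorem embedding_restrictNormal_symm_neg_one_apply (ψ : F →+* ℂ) (x : F) :
    ψ (((galEquivZMod n L).symm (-1)).restrictNormal F x) = starRingEnd ℂ (ψ x) := by
  letI : Algebra F ℂ := ψ.toAlgebra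
  haveI : Module.IsTorsionFree F ℂ := DivisionSemiring.to_moduleIsTorsionFree
  haveI : Module.IsTorsionFree F L := DivisionSemiring.to_moduleIsTorsionFree
  let Ψ : L →ₐ[F] ℂ := IsAlgClosed.lift
  have hΨ : ∀ y : F, Ψ (algebraMap F L y) = ψ y := fun y ↦ Ψ.commutes y
  rw [← hΨ, ← hΨ, AlgEquiv.restrictNormal_commutes]
  exact embedding_symm_neg_one_apply (n := n) L Ψ.toRingHom _

/-- An element of a normal subfield `F ⊆ ℚ(ζ_n)` lies in the maximal real subfield of `F` iff
it is fixed by `σ_{-1}`. [folklore] -/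
theorem mem_maximalRealSubfield_iff_restrictNormal (x : F) :
    x ∈ maximalRealSubfield F ↔ ((galEquivZMod n L).symm (-1)).restrictNormal F x = x := by
  rw [mem_maximalRealSubfield_iff]
  constructor
  · intro h
    obtain ⟨ψ⟩ : Nonempty (F →+* ℂ) := inferInstance
    apply ψ.injective
    rw [embedding_restrictNormal_symm_neg_one_apply (n := n) L F ψ x]
    exact h ψ
  · intro h ψ
    rw [Complex.star_def, ← embedding_restrictNormal_symm_neg_one_apply (n := n) L F ψ x, h]

omit [Normal ℚ F] in
/-- Membership in the real subfield `F₊ = L^{⟨Gal(L/F), σ_{-1}⟩}` of `F`: `y ∈ F₊ ↔ y ∈ F ∧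
σ_{-1} y = y`. [folklore] -/
theorem mem_fixedField_sup_zpowers_iff (y : L) :
    y ∈ fixedField (F.fixingSubgroup ⊔ Subgroup.zpowers ((galEquivZMod n L).symm (-1))) ↔
      y ∈ F ∧ (galEquivZMod n L).symm (-1) y = y := by
  haveI : IsGalois ℚ L := IsCyclotomicExtension.isGalois {n} ℚ L
  rw [mem_fixedField_iff]
  constructor
  · intro h
    refine ⟨?_, h _ (Subgroup.mem_sup_right (Subgroup.mem_zpowers _))⟩
    have h' : y ∈ fixedField F.fixingSubgroup :=
      (mem_fixedField_iff _ _).mpr fun f hf ↦ h f (Subgroup.mem_sup_left hf)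
    rwa [IsGalois.fixedField_fixingSubgroup] at h'
  · rintro ⟨hyF, hyσ⟩ f hf
    have hle : F.fixingSubgroup ⊔ Subgroup.zpowers ((galEquivZMod n L).symm (-1)) ≤
        MulAction.stabilizer (L ≃ₐ[ℚ] L) y := by
      rw [sup_le_iff, Subgroup.zpowers_le, MulAction.mem_stabilizer_iff]
      refine ⟨fun g hg ↦ ?_, hyσ⟩
      rw [MulAction.mem_stabilizer_iff]
      exact (mem_fixingSubgroup_iff F g).mp hg y hyF
    exact hle hf

/-- **The real subfield of `F` inside `ℚ(ζ_n)` is isomorphic to Mathlib's maximal real subfield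
of `F`**: `L^{⟨Gal(L/F), σ_{-1}⟩} ≃+* maximalRealSubfield F`. [folklore] -/
theorem nonempty_ringEquiv_fixedField_maximalRealSubfield :
    Nonempty (fixedField (F.fixingSubgroup ⊔ Subgroup.zpowers ((galEquivZMod n L).symm (-1))) ≃+*
      maximalRealSubfield F) := by
  set σ := (galEquivZMod n L).symm (-1) with hσ
  have hmem := mem_fixedField_sup_zpowers_iff (n := n) L F
  have hreal : ∀ x : F, x ∈ maximalRealSubfield F ↔ σ (x : L) = x := by
    intro x
    rw [mem_maximalRealSubfield_iff_restrictNormal (n := n) L F x, ← hσ]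
    constructor
    · intro h
      have := congrArg (algebraMap F L) h
      rwa [AlgEquiv.restrictNormal_commutes] at this
    · intro h
      apply (algebraMap F L).injective
      rw [AlgEquiv.restrictNormal_commutes]
      exact h
  refine ⟨{ toFun := fun y ↦ ⟨⟨y.1, ((hmem y.1).mp y.2).1⟩, (hreal _).mpr ((hmem y.1).mp y.2).2⟩
            invFun := fun x ↦ ⟨((x : F) : L), (hmem _).mpr ⟨(x : F).2, (hreal _).mp x.2⟩⟩
            left_inv := fun y ↦ rfl
            right_inv := fun x ↦ rfl
            map_mul' := fun y z ↦ rfl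
            map_add' := fun y z ↦ rfl }⟩

end Conj

/-! ## 3a. `L(0, χ⋆) = -B_{1,χ⋆}` in the normalisation of `bernoulliOneChar` -/

section Bernoulli

open DirichletCharacter

/-- A sum over `0, …, f-1` of a function on `ℤ/f` is the sum over `ℤ/f`. [folklore] -/
theorem sum_range_natCast_eq_sum {f : ℕ} [NeZero f] (g : ZMod f → ℂ) :
    ∑ a ∈ Finset.range f, g (a : ZMod f) = ∑ a : ZMod f, g a := by
  obtain ⟨k, rfl⟩ := Nat.exists_eq_succ_of_ne_zero (NeZero.ne f)
  rw [Finset.sum_range]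
  refine Fintype.sum_congr _ _ fun i ↦ ?_
  congr 1
  exact ZMod.natCast_zmod_val (n := k + 1) i

/-- For an odd Dirichlet character `θ` modulo `f`, `L(0, θ) = -B_{1,θ}` with
`B_{1,θ} = Σ_{a=0}^{f-1} θ(a)(a/f - 1/2)` (`bernoulliOneChar`; the tree's
`dirichletLFunction_apply_zero_of_odd` in Lang's normalisation of `B_{1,χ}`).
[cite: Lang1990, Ch. 2 §1 (definition of B_{1,χ}) and Ch. 3 §2] -/
theorem LFunction_zero_eq_neg_bernoulliOneChar {f : ℕ} [NeZero f] {θ : DirichletCharacter ℂ f}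
    (hθ : θ.Odd) : θ.LFunction 0 = -bernoulliOneChar θ := by
  rw [LValueZero.dirichletLFunction_apply_zero_of_odd hθ, bernoulliOneChar]
  have hne : θ ≠ 1 := by
    rintro rfl
    have h1 : (1 : DirichletCharacter ℂ f) (-1) = 1 := by
      rw [show (-1 : ZMod f) = ((-1 : (ZMod f)ˣ) : ZMod f) by simp]
      exact MulChar.one_apply_coe _
    have h2 : (1 : DirichletCharacter ℂ f) (-1) = -1 := hθ
    rw [h1] at h2
    norm_num at h2
  have hsum0 : ∑ a : ZMod f, θ a = 0 := MulChar.sum_eq_zero_of_ne_one hne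
  have h1 : ∑ a ∈ Finset.range f, θ (a : ZMod f) * (((a : ℂ) / (f : ℂ)) - 1 / 2) =
      ∑ a ∈ Finset.range f, (fun b : ZMod f ↦ θ b * (((b.val : ℂ) / (f : ℂ)) - 1 / 2))
        (a : ZMod f) := by
    refine Finset.sum_congr rfl fun a ha ↦ ?_
    rw [Finset.mem_range] at ha
    simp only [ZMod.val_natCast_of_lt ha]
  rw [h1, sum_range_natCast_eq_sum (fun b : ZMod f ↦ θ b * (((b.val : ℂ) / (f : ℂ)) - 1 / 2))]
  have h2 : ∑ b : ZMod f, θ b * (((b.val : ℂ) / (f : ℂ)) - 1 / 2) =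
      (∑ b : ZMod f, (b.val : ℂ) * θ b) / f - (1 / 2) * ∑ b : ZMod f, θ b := by
    rw [Finset.sum_div, Finset.mul_sum, ← Finset.sum_sub_distrib]
    refine Finset.sum_congr rfl fun b _ ↦ ?_
    ring
  rw [h2, hsum0, mul_zero, sub_zero, neg_div]

/-- The primitive character of an odd character is odd. [folklore] -/
theorem Odd.primitiveCharacter {m : ℕ} [NeZero m] {χ : DirichletCharacter ℂ m} (hχ : χ.Odd) :
    χ.primitiveCharacter.Odd := by
  have h := primitiveCharacter_apply_of_isCoprime χ (a := -1) (isCoprime_one_left.neg_left)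
  rw [DirichletCharacter.Odd]
  push_cast at h
  rw [h]
  exact hχ

end Bernoulli

/-! ## 3b. A totally real field has exactly two roots of unity -/

section Torsion

open NumberField.Units

/-- `w = 2` for a totally real number field (a root of unity of order `> 2` forces
`r₁ = 0`). (Lang, *Cyclotomic Fields I*, Ch. 3 §3, p. 77: "the number of roots of unity in `K`
when `K` is real is equal to `2`".) [folklore] -/
theorem torsionOrder_eq_two_of_isTotallyReal (K : Type*) [Field K] [NumberField K]
    [IsTotallyReal K] : torsionOrder K = 2 := by
  have hpos : 0 < nrRealPlaces K := by
    rw [← IsTotallyReal.finrank]; exact Module.finrank_pos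
  obtain ⟨g, hg⟩ := IsCyclic.exists_ofOrder_eq_natCard (α := torsion K)
  have ht : orderOf ((g : (𝓞 K)ˣ) : K) = torsionOrder K := by
    rw [torsionOrder, ← hg, ← Subgroup.orderOf_coe g, ← orderOf_units,
      ← orderOf_injective (algebraMap (𝓞 K) K).toMonoidHom (RingOfIntegers.coe_injective)]
    rfl
  have hle : ¬ 2 < torsionOrder K := by
    intro hlt
    have h0 := IsPrimitiveRoot.nrRealPlaces_eq_zero_of_two_lt hlt
      (ht ▸ IsPrimitiveRoot.orderOf ((g : (𝓞 K)ˣ) : K))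
    omega
  have heven := Nat.even_iff.mp (even_torsionOrder K)
  have hpos' := torsionOrder_pos K
  omega

end Torsion

/-! ## 4. Assembly: the relative class number formula -/

section Main

open DirichletCharacter IsCyclotomicExtension.Rat IntermediateField NumberField.Units
  NumberField.InfinitePlace AbelianDedekindZeta RelativeClassNumber Finset
open scoped Classical Real

/-- `|d|^{1/2}` as a complex power of the natural number `|d|` is the real square root. [folklore] -/
theorem natAbs_cpow_half (d : ℤ) :
    ((d.natAbs : ℂ)) ^ ((1 : ℂ) / 2) = ((Real.sqrt |(d : ℝ)| : ℝ) : ℂ) := by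
  have h1 : ((d.natAbs : ℂ)) = ((|(d : ℝ)| : ℝ) : ℂ) := by
    rw [← Complex.ofReal_natCast, Nat.cast_natAbs, Int.cast_abs]
  rw [h1, Real.sqrt_eq_rpow, Complex.ofReal_cpow (abs_nonneg _)]
  norm_num

/-- The character group `X(F)` of `F = L^H` has `[F : ℚ]` elements. [folklore] -/
theorem card_characterGroup {n : ℕ} [NeZero n] (L : Type*) [Field L] [NumberField L]
    [IsCyclotomicExtension {n} ℚ L] (F : IntermediateField ℚ L) :
    #({χ | ∀ σ ∈ F.fixingSubgroup, χ (galEquivZMod n L σ) = 1} :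
        Finset (DirichletCharacter ℂ n)) = Module.finrank ℚ F := by
  haveI : IsGalois ℚ L := IsCyclotomicExtension.isGalois {n} ℚ L
  have h := card_filter_forall_apply_eq_one (F.fixingSubgroup.map (galEquivZMod n L).toMonoidHom)
  have h2 : (F.fixingSubgroup.map (galEquivZMod n L).toMonoidHom).index = F.fixingSubgroup.index := by
    rw [MulEquiv.toMonoidHom_eq_coe]
    exact Subgroup.index_map_equiv F.fixingSubgroup (galEquivZMod n L)
  rw [h2, ← finrank_eq_fixingSubgroup_index] at h
  rw [← h]
  congr 1
  ext χ
  simp only [Finset.mem_filter, Finset.mem_univ, true_and, Subgroup.mem_map,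
    forall_exists_index, and_imp]
  constructor
  · rintro hχ _ σ hσ rfl
    exact hχ σ hσ
  · intro hχ σ hσ
    exact hχ _ σ hσ rfl

end Main

end RelativeClassNumber

section Main

open DirichletCharacter IsCyclotomicExtension.Rat IntermediateField NumberField.Units
  NumberField.InfinitePlace AbelianDedekindZeta RelativeClassNumber Finset
open scoped Classical Real

/-- **The relative class number formula holds** (discharge of
`Lang1990_relativeClassNumberFormula`; Lang, *Cyclotomic Fields I and II*, Ch. 3 §3, Thm. 3.2 and
formula CNF⁻). See the module docstring for the proof. [cite: Lang1990, Ch. 3 §3, Theorem 3.2 and CNF⁻] -/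
theorem Lang1990_relativeClassNumberFormula_holds : Lang1990_relativeClassNumberFormula := by
  intro n _ L _ _ _ F _ _
  haveI : IsGalois ℚ L := IsCyclotomicExtension.isGalois {n} ℚ L
  haveI : IsAbelianGalois ℚ L := IsCyclotomicExtension.isAbelianGalois {n} ℚ L
  haveI : IsMulCommutative (L ≃ₐ[ℚ] L) := IsAbelianGalois.toIsMulCommutative
  -- notation
  set e := galEquivZMod n L with he
  set σc : L ≃ₐ[ℚ] L := e.symm (-1) with hσc
  set H := F.fixingSubgroup with hH
  set Fplus : IntermediateField ℚ L := fixedField (H ⊔ Subgroup.zpowers σc) with hFplus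
  set Y : Finset (DirichletCharacter ℂ n) := {χ | ∀ σ ∈ H, χ (e σ) = 1} with hY
  -- `L⋆(χ, s)`
  set Lstar : DirichletCharacter ℂ n → ℂ → ℂ := fun χ s ↦
    (haveI : NeZero χ.conductor := ⟨χ.conductor_ne_zero⟩; χ.primitiveCharacter.LFunction s)
    with hLstar
  /- Step 1: `ζ_F(s) = ∏_{χ ∈ Y} L⋆(χ, s)` and `ζ_{Fplus}(s) = ∏_{χ ∈ Y, even} L⋆(χ, s)` -/
  have hζF : ∀ s : ℂ, s ≠ 1 → dedekindZetaCont F s = ∏ χ ∈ Y, Lstar χ s := fun s hs ↦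
    dedekindZetaCont_eq_prod_characterGroup_LFunction L F hs
  have hfixplus : Fplus.fixingSubgroup = H ⊔ Subgroup.zpowers σc := fixingSubgroup_fixedField _
  have heσ : e σc = -1 := by rw [hσc, MulEquiv.apply_symm_apply]
  have hYplus : ({χ | ∀ σ ∈ Fplus.fixingSubgroup, χ (galEquivZMod n L σ) = 1} :
      Finset (DirichletCharacter ℂ n)) = Y.filter (fun χ ↦ χ.Even) := by
    ext χ
    simp only [Finset.mem_filter, Finset.mem_univ, true_and, hY, hfixplus]
    constructor
    · intro h
      refine ⟨fun σ hσ ↦ h σ (Subgroup.mem_sup_left hσ), ?_⟩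
      have := h σc (Subgroup.mem_sup_right (Subgroup.mem_zpowers _))
      rw [heσ, Units.val_neg, Units.val_one] at this
      exact this
    · rintro ⟨hH', hev⟩ σ hσ
      have hle : H ⊔ Subgroup.zpowers σc ≤ (MulChar.toUnitHom χ).ker.comap e.toMonoidHom := by
        rw [sup_le_iff, Subgroup.zpowers_le]
        refine ⟨fun τ hτ ↦ ?_, ?_⟩
        · rw [Subgroup.mem_comap, MonoidHom.mem_ker, Units.ext_iff, MulChar.coe_toUnitHom]
          exact hH' τ hτ
        · rw [Subgroup.mem_comap, MonoidHom.mem_ker, Units.ext_iff, MulChar.coe_toUnitHom,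
            MulEquiv.coe_toMonoidHom, heσ, Units.val_neg, Units.val_one]
          exact hev
      have := hle hσ
      rwa [Subgroup.mem_comap, MonoidHom.mem_ker, Units.ext_iff, MulChar.coe_toUnitHom] at this
  have hζFplus : ∀ s : ℂ, s ≠ 1 →
      dedekindZetaCont Fplus s = ∏ χ ∈ Y.filter (fun χ ↦ χ.Even), Lstar χ s := by
    intro s hs
    rw [← hYplus]
    exact dedekindZetaCont_eq_prod_characterGroup_LFunction L Fplus hs
  /- Step 2: `Fplus ≃ K⁺ := maximalRealSubfield F`, hence `ζ_{K⁺} = ζ_{Fplus}` -/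
  haveI : Normal ℚ F := inferInstance
  obtain ⟨ι⟩ := nonempty_ringEquiv_fixedField_maximalRealSubfield (n := n) L F
  have hAE : Literature.NumberTheory.NumberFields.ArithmeticallyEquivalent Fplus
      (maximalRealSubfield F) := fun p hp ↦
    Literature.NumberTheory.NumberFields.splittingType_eq_of_ringEquiv
      (NumberField.RingOfIntegers.mapRingEquiv ι) hp
  have hζeq : NumberField.dedekindZeta Fplus = NumberField.dedekindZeta (maximalRealSubfield F) :=
    hAE.dedekindZeta_eq
  have hζK : ∀ s : ℂ, s ≠ 1 → dedekindZetaCont (maximalRealSubfield F) s =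
      ∏ χ ∈ Y.filter (fun χ ↦ χ.Even), Lstar χ s := by
    have hcont : IsDedekindZetaContinuation (maximalRealSubfield F)
        (fun s ↦ ∏ χ ∈ Y.filter (fun χ ↦ χ.Even), Lstar χ s) := by
      refine ⟨fun s hs ↦ ?_, fun s hs ↦ ?_⟩
      · refine (DifferentiableAt.fun_finsetProd fun χ _ ↦ ?_).differentiableWithinAt
        haveI : NeZero χ.conductor := ⟨χ.conductor_ne_zero⟩
        exact DirichletCharacter.differentiableAt_LFunction _ s (Or.inl hs)
      · have hs1 : s ≠ 1 := by
          intro h; rw [h] at hs; simp at hs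
        show ∏ χ ∈ Y.filter (fun χ ↦ χ.Even), Lstar χ s =
          NumberField.dedekindZeta (maximalRealSubfield F) s
        rw [← hζeq, ← hζFplus s hs1]
        exact dedekindZetaCont_eq_dedekindZeta_holds hs
    intro s hs
    exact (IsDedekindZetaContinuation.eqOn_dedekindZetaCont_holds hcont hs).symm
  /- Step 3: the odd part `R(s) = ∏_{χ odd} L⋆(χ, s)` is entire and `ζ_F = ζ_{K⁺} · R` -/
  set R : ℂ → ℂ := fun s ↦ ∏ χ ∈ Y.filter (fun χ ↦ χ.Odd), Lstar χ s with hRdef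
  have hodd_ne : ∀ χ : DirichletCharacter ℂ n, χ.Odd → χ ≠ 1 := by
    rintro χ hχ rfl
    have h1 : (1 : DirichletCharacter ℂ n) (-1) = 1 := by
      rw [show (-1 : ZMod n) = ((-1 : (ZMod n)ˣ) : ZMod n) by simp]
      exact MulChar.one_apply_coe _
    rw [DirichletCharacter.Odd, h1] at hχ
    norm_num at hχ
  have hRdiff : Differentiable ℂ R := by
    rw [hRdef]
    refine Differentiable.fun_finsetProd fun χ hχ ↦ ?_
    rw [Finset.mem_filter] at hχ
    haveI : NeZero χ.conductor := ⟨χ.conductor_ne_zero⟩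
    have hne : χ.primitiveCharacter ≠ 1 := by
      intro h1
      have hc : χ.conductor ≠ 1 := by
        rw [Ne, ← eq_one_iff_conductor_eq_one]; exact hodd_ne χ hχ.2
      apply hc
      have := (isPrimitive_def _).mp χ.primitiveCharacter_isPrimitive
      rw [h1, conductor_one] at this
      exact this.symm
    exact DirichletCharacter.differentiable_LFunction hne
  have hsplit : ∀ s : ℂ, ∏ χ ∈ Y, Lstar χ s =
      (∏ χ ∈ Y.filter (fun χ ↦ χ.Even), Lstar χ s) * R s := by
    intro s
    rw [hRdef, ← Finset.prod_filter_mul_prod_filter_not Y (fun χ ↦ χ.Even)]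
    congr 1
    refine Finset.prod_congr ?_ fun _ _ ↦ rfl
    ext χ
    simp only [Finset.mem_filter, and_congr_right_iff]
    intro _
    constructor
    · intro h; rcases χ.even_or_odd with h' | h'
      · exact absurd h' h
      · exact h'
    · intro h; exact h.not_even
  have hR : ∀ s : ℂ, s ≠ 1 →
      dedekindZetaCont F s = dedekindZetaCont (maximalRealSubfield F) s * R s := by
    intro s hs
    rw [hζF s hs, hζK s hs, hsplit s]
  /- Step 4: signatures and degrees -/
  set r := nrComplexPlaces F with hr
  have hF0 : nrRealPlaces F = 0 := IsTotallyComplex.nrRealPlaces_eq_zero F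
  have hK0 : nrComplexPlaces (maximalRealSubfield F) = 0 :=
    IsTotallyReal.nrComplexPlaces_eq_zero _
  have hdegF : Module.finrank ℚ F = 2 * r := IsTotallyComplex.finrank F
  have hdeg2 : Module.finrank (maximalRealSubfield F) F = 2 :=
    Algebra.IsQuadraticExtension.finrank_eq_two (maximalRealSubfield F) F
  have hdegK : Module.finrank ℚ (maximalRealSubfield F) = r := by
    have h := Module.finrank_mul_finrank ℚ (maximalRealSubfield F) F
    rw [hdeg2, hdegF] at h
    omega
  have hKr : nrRealPlaces (maximalRealSubfield F) = r := by
    rw [← IsTotallyReal.finrank, hdegK]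
  have hrank : rank F + 1 = r := by
    rw [rank, card_eq_nrRealPlaces_add_nrComplexPlaces, hF0, zero_add, ← hr]
    have : 0 < r := by
      rw [← hdegK]; exact Module.finrank_pos
    omega
  -- `|Y| = 2r`, `|Y_even| = r`, `|Y_odd| = r`
  have hYcard : #Y = 2 * r := by rw [hY, he, card_characterGroup L F, hdegF]
  have hYeven : #(Y.filter (fun χ ↦ χ.Even)) = r := by
    rw [← hYplus, card_characterGroup L Fplus]
    -- `[Fplus : ℚ] = [K⁺ : ℚ]`
    have hι : Module.finrank ℚ Fplus = Module.finrank ℚ (maximalRealSubfield F) := by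
      let ι' : Fplus ≃ₐ[ℚ] maximalRealSubfield F := AlgEquiv.ofRingEquiv (f := ι) fun x ↦
        congrFun (congrArg DFunLike.coe
          (RingHom.ext_rat (ι.toRingHom.comp (algebraMap ℚ Fplus))
            (algebraMap ℚ (maximalRealSubfield F)))) x
      exact ι'.toLinearEquiv.finrank_eq
    rw [hι, hdegK]
  have hYodd : #(Y.filter (fun χ ↦ χ.Odd)) = r := by
    have h := Finset.card_filter_add_card_filter_not (s := Y) (fun χ ↦ χ.Even)
    rw [hYcard, hYeven] at h
    have h2 : Y.filter (fun χ ↦ ¬ χ.Even) = Y.filter (fun χ ↦ χ.Odd) := by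
      ext χ
      simp only [Finset.mem_filter, and_congr_right_iff]
      intro _
      constructor
      · intro h'; rcases χ.even_or_odd with h'' | h''
        · exact absurd h'' h'
        · exact h''
      · intro h'; exact h'.not_even
    rw [h2] at h
    omega
  /- Step 5: the analytic comparison -/
  have hmain := cpow_discr_mul_mul_residue_eq (K := F) (K' := maximalRealSubfield F) hF0 hK0
    (by rw [hKr]) (hRdiff.continuous.continuousAt) (hRdiff.continuous.continuousAt) hR
  /- Step 6: `R(0) = ∏_{χ odd} (-B_{1,χ⋆})` -/
  have hR0 : R 0 = ∏ χ ∈ Y.filter (fun χ ↦ χ.Odd), (-bernoulliOneChar χ.primitiveCharacter) := by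
    rw [hRdef]
    refine Finset.prod_congr rfl fun χ hχ ↦ ?_
    rw [Finset.mem_filter] at hχ
    haveI : NeZero χ.conductor := ⟨χ.conductor_ne_zero⟩
    simp only [hLstar]
    exact LFunction_zero_eq_neg_bernoulliOneChar (Odd.primitiveCharacter hχ.2)
  /- Step 7: evaluate the residues and conclude -/
  -- real quantities
  have hsqrtF := natAbs_cpow_half (NumberField.discr F)
  have hsqrtK := natAbs_cpow_half (NumberField.discr (maximalRealSubfield F))
  have hwK : torsionOrder (maximalRealSubfield F) = 2 := torsionOrder_eq_two_of_isTotallyReal _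
  have hreg := NumberField.IsCMField.regulator_div_regulator_eq_two_pow_mul_indexRealUnits_inv F
  -- positivity
  have hdF : 0 < Real.sqrt |(NumberField.discr F : ℝ)| :=
    Real.sqrt_pos.mpr (abs_pos.mpr (Int.cast_ne_zero.mpr (NumberField.discr_ne_zero F)))
  have hdK : 0 < Real.sqrt |(NumberField.discr (maximalRealSubfield F) : ℝ)| :=
    Real.sqrt_pos.mpr (abs_pos.mpr (Int.cast_ne_zero.mpr (NumberField.discr_ne_zero _)))
  have hregF := regulator_pos F
  have hregK := regulator_pos (maximalRealSubfield F)
  have hwF := torsionOrder_pos F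
  have hQ : 0 < (NumberField.IsCMField.indexRealUnits F : ℝ) := by
    rcases NumberField.IsCMField.indexRealUnits_eq_one_or_two F with h | h <;> simp [h]
  have hhK := classNumber_pos (maximalRealSubfield F)
  rw [NumberField.dedekindZeta_residue_def, NumberField.dedekindZeta_residue_def, hF0, hK0, hKr,
    hwK, hsqrtF, hsqrtK, hR0] at hmain
  -- regulator of `F` in terms of `Reg⁺` and `Q`
  have hregF' : regulator F = 2 ^ rank F * (NumberField.IsCMField.indexRealUnits F : ℝ)⁻¹ *
      regulator (maximalRealSubfield F) := by
    rw [← hreg, div_mul_cancel₀ _ hregK.ne']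
  rw [hregF'] at hmain
  -- the statement: `∏ (-(1/2) B) = (1/2)^r ∏ (-B)`
  rw [show ({χ : DirichletCharacter ℂ n | (∀ σ : L ≃ₐ[ℚ] L, σ ∈ F.fixingSubgroup →
        χ (galEquivZMod n L σ) = 1) ∧ χ.Odd}) =
      ((Y.filter (fun χ ↦ χ.Odd) : Finset (DirichletCharacter ℂ n)) : Set _) by
    ext χ; simp [hY, hH, he],
    finprod_mem_coe_finset]
  have hT : ∏ χ ∈ Y.filter (fun χ ↦ χ.Odd), (-(1 / 2 : ℂ) * bernoulliOneChar χ.primitiveCharacter) =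
      (1 / 2 : ℂ) ^ (rank F + 1) *
        ∏ χ ∈ Y.filter (fun χ ↦ χ.Odd), (-bernoulliOneChar χ.primitiveCharacter) := by
    have h1 : ∏ χ ∈ Y.filter (fun χ ↦ χ.Odd), (-(1 / 2 : ℂ) * bernoulliOneChar χ.primitiveCharacter) =
        ∏ χ ∈ Y.filter (fun χ ↦ χ.Odd), ((1 / 2 : ℂ) * (-bernoulliOneChar χ.primitiveCharacter)) :=
      Finset.prod_congr rfl fun _ _ ↦ by ring
    rw [h1, Finset.prod_mul_distrib, Finset.prod_const, hYodd, hrank]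
  rw [hT]
  set P := ∏ χ ∈ Y.filter (fun χ ↦ χ.Odd), (-bernoulliOneChar χ.primitiveCharacter) with hP
  rw [← hr, ← hrank] at hmain
  simp only [pow_zero, one_mul, mul_one, inv_pow, one_div, mul_pow] at hmain ⊢
  have hπ : (π : ℂ) ≠ 0 := Complex.ofReal_ne_zero.mpr Real.pi_ne_zero
  have hdF' : ((Real.sqrt |(NumberField.discr F : ℝ)| : ℝ) : ℂ) ≠ 0 :=
    Complex.ofReal_ne_zero.mpr hdF.ne'
  have hdK' : ((Real.sqrt |(NumberField.discr (maximalRealSubfield F) : ℝ)| : ℝ) : ℂ) ≠ 0 :=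
    Complex.ofReal_ne_zero.mpr hdK.ne'
  have hregK' : ((regulator (maximalRealSubfield F) : ℝ) : ℂ) ≠ 0 :=
    Complex.ofReal_ne_zero.mpr hregK.ne'
  have hwF' : ((torsionOrder F : ℕ) : ℂ) ≠ 0 := Nat.cast_ne_zero.mpr hwF.ne'
  have hQ' : ((NumberField.IsCMField.indexRealUnits F : ℕ) : ℂ) ≠ 0 := by
    rcases NumberField.IsCMField.indexRealUnits_eq_one_or_two F with h | h <;> simp [h]
  push_cast at hmain ⊢
  field_simp at hmain
  have hmain' : P * (classNumber (maximalRealSubfield F) : ℂ) *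
      (NumberField.IsCMField.indexRealUnits F : ℂ) * (torsionOrder F : ℂ) =
      2 ^ (rank F + 1) * (classNumber F : ℂ) := by
    linear_combination hmain
  field_simp
  linear_combination -hmain'

end Main



end Literature.NumberTheory.LFunctions
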